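import Summits.KontsevichZagierPeriods.KontsevichZagierPeriods.Theses.TorsionLogs
import Literature.NumberTheory.Transcendental.EllIterRepShuffle

/-!
# Route TorsionLogs — `TriangleConcatenation` (item stmt-KontsevichZagierPeriods-13809)

Chen concatenation of length-two iterated integrals is domain additivity in the
Kontsevich–Zagier calculus of moves: for `a < b < c` the ordered triangle `{a < x′ < x < c}` is,
off the two null lines `x = b` and `x′ = b`, the disjoint union of the triangles
`{a < x′ < x < b}`, `{b < x′ < x < c}` and the rectangle `{a < x′ < b < x < c}`; for
representations carrying the common product integrand `φ(x′)ψ(x)` the class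
`[r] − [r₁] − [r₂] − [r₃]` lies in `KZ.relations` — iterated rule (1a)
(`KZ.of_sub_sum_of_mem_relations_of_subset`), the null remainder being level junk
(`KZ.of_mem_levelRel_of_volume_eq_zero`, through that lemma).

## References

* M. Kontsevich, D. Zagier, *Periods* (2001), §1.2, rule (1). [KontsevichZagier2001]
* K.-T. Chen, *Iterated path integrals*, Bull. AMS 83 (1977), §1.5. [Chen1977]
-/

namespace Summit.KontsevichZagierPeriods.KontsevichZagierPeriods.Theorems

open MeasureTheory Set
open Literature.NumberTheory.Transcendental Literature.NumberTheory.Transcendental.KZ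

/-- A coordinate line `{z | z i = b}` of the plane `Fin 2 → ℝ` is Lebesgue-null
(`MeasureTheory.Measure.pi_hyperplane`). -/
theorem volume_setOf_apply_eq_const_fin_two (i : Fin 2) (b : ℝ) :
    volume {z : Fin 2 → ℝ | z i = b} = 0 :=
  Measure.pi_hyperplane (fun _ => (volume : Measure ℝ)) i b

/-- **Triangle concatenation** (item stmt-KontsevichZagierPeriods-13809 of route TorsionLogs):
for `a < b < c` and representations `r`, `r₁`, `r₂`, `r₃` on the ordered triangle
`{a < z 1 < z 0 < c}`, the triangles `{a < z 1 < z 0 < b}`, `{b < z 1 < z 0 < c}` and the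
rectangle `{a < z 1 < b < z 0 < c}`, all with integrand `φ (z 1) * ψ (z 0)` on their domains,
`[r] − [r₁] − [r₂] − [r₃] ∈ KZ.relations`. Proof: the three pieces are pairwise disjoint
subsets of the big triangle covering it off `{z 0 = b} ∪ {z 1 = b}` (Lebesgue-null), so the
finite-partition form of domain additivity `KZ.of_sub_sum_of_mem_relations_of_subset` applies.
[Kontsevich–Zagier 2001, §1.2, rule (1); Chen 1977, §1.5] -/
theorem triangleConcatenation_proof :
    Summit.KontsevichZagierPeriods.KontsevichZagierPeriods.Theses.TorsionLogs.TriangleConcatenation := by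
  intro a b c φ ψ hab hbc r r₁ r₂ r₃ hr hr₁ hr₂ hr₃ hi hi₁ hi₂ hi₃
  -- the three pieces lie in the big triangle
  have hs₁ : r₁.domain ⊆ r.domain := by
    rw [hr, hr₁]
    exact fun z h => ⟨h.1, h.2.1, h.2.2.trans hbc⟩
  have hs₂ : r₂.domain ⊆ r.domain := by
    rw [hr, hr₂]
    exact fun z h => ⟨hab.trans h.1, h.2.1, h.2.2⟩
  have hs₃ : r₃.domain ⊆ r.domain := by
    rw [hr, hr₃]
    exact fun z h => ⟨h.1, h.2.1.trans h.2.2.1, h.2.2.2⟩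
  -- and are pairwise disjoint
  have d₁₂ : Disjoint r₁.domain r₂.domain := by
    rw [hr₁, hr₂]
    exact Set.disjoint_left.2 fun z h h' => lt_asymm (lt_trans h.2.2 h'.1) h'.2.1
  have d₁₃ : Disjoint r₁.domain r₃.domain := by
    rw [hr₁, hr₃]
    exact Set.disjoint_left.2 fun z h h' => lt_asymm h.2.2 h'.2.2.1
  have d₂₃ : Disjoint r₂.domain r₃.domain := by
    rw [hr₂, hr₃]
    exact Set.disjoint_left.2 fun z h h' => lt_asymm h.1 h'.2.1
  -- integrands agree with that of `r` on each piece
  have he₁ : EqOn r₁.integrand r.integrand r₁.domain :=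
    fun z hz => (hi₁ hz).trans (hi (hs₁ hz)).symm
  have he₂ : EqOn r₂.integrand r.integrand r₂.domain :=
    fun z hz => (hi₂ hz).trans (hi (hs₂ hz)).symm
  have he₃ : EqOn r₃.integrand r.integrand r₃.domain :=
    fun z hz => (hi₃ hz).trans (hi (hs₃ hz)).symm
  -- the remainder lies in the two null lines `z 0 = b`, `z 1 = b`
  have hrem : r.domain \ (r₁.domain ∪ r₂.domain ∪ r₃.domain) ⊆
      {z : Fin 2 → ℝ | z 0 = b} ∪ {z | z 1 = b} := by
    rintro z ⟨hz, hnot⟩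
    rw [hr] at hz
    rw [hr₁, hr₂, hr₃] at hnot
    simp only [mem_union, mem_setOf_eq, not_or] at hnot
    obtain ⟨⟨h₁, h₂⟩, h₃⟩ := hnot
    rcases lt_trichotomy (z 0) b with h0 | h0 | h0
    · exact absurd ⟨hz.1, hz.2.1, h0⟩ h₁
    · exact Or.inl h0
    · rcases lt_trichotomy (z 1) b with h1 | h1 | h1
      · exact absurd ⟨hz.1, h1, h0, hz.2.2⟩ h₃
      · exact Or.inr h1
      · exact absurd ⟨h1, hz.2.1, hz.2.2⟩ h₂
  have hnull : volume (r.domain \ (r₁.domain ∪ r₂.domain ∪ r₃.domain)) = 0 :=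
    measure_mono_null hrem (measure_union_null (volume_setOf_apply_eq_const_fin_two 0 b)
      (volume_setOf_apply_eq_const_fin_two 1 b))
  -- iterated domain additivity over the partition `![r₁, r₂, r₃]`
  have key := of_sub_sum_of_mem_relations_of_subset (Finset.univ : Finset (Fin 3)) r ![r₁, r₂, r₃]
    (by
      intro i _
      fin_cases i
      exacts [hs₁, hs₂, hs₃])
    (by
      intro i _
      fin_cases i
      exacts [he₁, he₂, he₃])
    (by
      -- the union of the three pieces is contained in the indexed union
      have hU : r₁.domain ∪ r₂.domain ∪ r₃.domain ⊆
          ⋃ i ∈ (Finset.univ : Finset (Fin 3)), (![r₁, r₂, r₃] i).domain := by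
        intro z hz
        simp only [Finset.mem_univ, iUnion_true, mem_iUnion]
        rcases hz with (hz | hz) | hz
        exacts [⟨0, hz⟩, ⟨1, hz⟩, ⟨2, hz⟩]
      exact measure_mono_null (sdiff_subset_sdiff_right hU) hnull)
    (by
      intro i _ j _ hij
      fin_cases i <;> fin_cases j
      all_goals
        first
        | exact absurd rfl hij
        | exact d₁₂
        | exact d₁₂.symm
        | exact d₁₃
        | exact d₁₃.symm
        | exact d₂₃
        | exact d₂₃.symm)
  rw [Fin.sum_univ_three] at key
  change of r - (of r₁ + of r₂ + of r₃) ∈ relations at key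
  have : of r - of r₁ - of r₂ - of r₃ = of r - (of r₁ + of r₂ + of r₃) := by abel
  rw [this]
  exact key

end Summit.KontsevichZagierPeriods.KontsevichZagierPeriods.Theorems
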